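import Summits.CriticalPhenomena.PercolationContinuityZ3.Theorems.PercNearOneGluingNoHeavyLowerTailSahiGridPatternLiteralTwoAbsorbCore

/-!
# `NoHeavyLowerTail` (crux stmt-CriticalPhenomena-4575), Sahi programme P1: **A LITERAL AND A GOOD SET IS GOOD** (both thresholds) —
# `sStarD (L × U') B C` is bounded below by goodness atoms of `U'`, for EVERY up-set `U'` (certificate-free pair-sum identity)

Support file (Sahi cell, seat `prim-sahi-p1`, generation 25; `--supports stmt-CriticalPhenomena-4575`).  Pure proofs, no definitions, no `sorry`.
`A = L × U' ⊆ [3]^{1+k}` with `L` the threshold-2 literal on the first axis (sections `(A_0,A_1,A_2) = (∅, ∅, U')`); the theorem bounds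
`sStarD A B C` below by a nonnegative integer combination of pattern functionals of `U'` in dimension `k` (and of the cylinder `[3]×U'`), so that
`U'` good ⇒ `L × U'` good (`…_nonneg_of_good`).  Identity found by LP over the 6-fold-symmetrised kernel space (kit j205248/j205256, seat memo
FROM-prim-sahi-p1-gen25 §10.8) and checked here by `ring`; families: weighted fibre Kleitman (`pairKernel_kleitman_nonneg_weight`) and pointwise products.
Together with `sStarD_literalTwo_ge_sections` (literal OR good set) this is the one-axis case of the seat's goodness recursion. [this work]
-/

namespace Summit.CriticalPhenomena.PercolationContinuityZ3.Theorems.SahiGridPattern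

open Finset SahiGrid3
open scoped BigOperators

variable {n k d : ℕ}

/-! ### Kernel tools (private primed copies of the `…LiteralTwoGood` lemmas, to keep this file independent of that module's build state) -/

/-- **The pattern functional as a pair-sum kernel**: `sStarD V P R = Σ_{q,r}[q δ̸ r]·(1_P(q)1_R(q)(2·1_V(q) − 1_V(r)) − 1_P(q)1_R(r)·Θ)`
(the `λ`-part spread over the `2^k` partners of `q`). [this work] -/
private theorem sStarD_eq_pairSum_kernel' (V P R : Finset (Pd k)) :
    sStarD V P R = ∑ q : Pd k, ∑ r : Pd k, (if TotDist q r = true then (1:ℤ) else 0) *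
      (ind P q * ind R q * (2 * ind V q - ind V r) - ind P q * ind R r * (ind V q + ind V r - ind V (thirdPt q r))) := by
  rw [sStarD_eq_sum_lamU_sub_sum_thetaVal, sum_mem_eq_sum_ind_mul]
  have h1 : (∑ q : Pd k, ind (P ∩ R) q * lamU V q)
      = ∑ q : Pd k, ∑ r : Pd k, (if TotDist q r = true then (1:ℤ) else 0) * (ind P q * ind R q * (2 * ind V q - ind V r)) := by
    refine Finset.sum_congr rfl fun q _ => ?_
    rw [ind_inter_eq_mul]
    unfold lamU
    rw [nuCount_eq_sum_ind]
    have e2 : (2:ℤ) * 2 ^ k * ind V q = ∑ r : Pd k, (if TotDist q r = true then (1:ℤ) else 0) * (2 * ind V q) := by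
      rw [← Finset.sum_mul, sum_ite_totDist_eq_two_pow]; ring
    have e3 : (∑ p : Pd k, ind V p * (if TotDist p q = true then (1:ℤ) else 0))
        = ∑ r : Pd k, (if TotDist q r = true then (1:ℤ) else 0) * ind V r := by
      refine Finset.sum_congr rfl fun r _ => ?_
      rw [totDist_symm r q]; ring
    rw [e2, e3, ← Finset.sum_sub_distrib, Finset.mul_sum]
    refine Finset.sum_congr rfl fun r _ => ?_
    ring
  have h2 : (∑ q ∈ P, ∑ r ∈ R, thetaVal V q r)
      = ∑ q : Pd k, ∑ r : Pd k, (if TotDist q r = true then (1:ℤ) else 0) * (ind P q * ind R r * (ind V q + ind V r - ind V (thirdPt q r))) := by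
    rw [sum_mem_eq_sum_ind_mul]
    refine Finset.sum_congr rfl fun q _ => ?_
    rw [sum_mem_eq_sum_ind_mul, Finset.mul_sum]
    refine Finset.sum_congr rfl fun r _ => ?_
    rw [thetaVal_eq_ite_mul]; ring
  rw [h1, h2, ← Finset.sum_sub_distrib]
  refine Finset.sum_congr rfl fun q _ => ?_
  rw [← Finset.sum_sub_distrib]
  refine Finset.sum_congr rfl fun r _ => ?_
  ring


/-- **The pattern functional of ANY first slot as a two-block pair sum**: for every `A, B, C ⊆ [3]^{n+k}`,
`sStarD A B C = Σ_{ξ δ̸ η} Σ_{q δ̸ r} h`, `h` the three-copy kernel read at the glued points `(ξ,q), (η,r)` and their third point. [this work] -/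
private theorem sStarD_eq_glue_pairSum' (A B C : Finset (Pd (n + k))) :
    sStarD A B C = ∑ ξ : Pd n, ∑ η : Pd n, ∑ q : Pd k, ∑ r : Pd k,
      (if TotDist ξ η = true then (1:ℤ) else 0) * (if TotDist q r = true then (1:ℤ) else 0) *
        ( 2 * ind A (glue ξ q) * ind B (glue ξ q) * ind C (glue ξ q)
          - ind A (glue ξ q) * ind B (glue η r) * ind C (glue η r)
          - ind B (glue ξ q) * ind A (glue η r) * ind C (glue η r)
          - ind C (glue ξ q) * ind A (glue η r) * ind B (glue η r)
          + ind B (glue ξ q) * ind C (glue η r) * ind A (glue (thirdPt ξ η) (thirdPt q r)) ) := by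
  rw [sStarD_counting]
  have e1 : 2 * 2 ^ (n + k) * (∑ p : Pd (n + k), ind A p * ind B p * ind C p) =
      ∑ ξ : Pd n, ∑ η : Pd n, ∑ q : Pd k, ∑ r : Pd k, (if TotDist ξ η = true then (1:ℤ) else 0) * (if TotDist q r = true then (1:ℤ) else 0) *
        (2 * ind A (glue ξ q) * ind B (glue ξ q) * ind C (glue ξ q)) := by
    have hc : 2 * (2:ℤ) ^ (n + k) * (∑ p : Pd (n + k), ind A p * ind B p * ind C p)
        = 2 ^ n * 2 ^ k * (∑ p : Pd (n + k), 2 * (ind A p * ind B p * ind C p)) := by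
      rw [pow_add, Finset.mul_sum, Finset.mul_sum]
      refine Finset.sum_congr rfl fun p _ => ?_
      ring
    rw [hc, sum_eq_pairSum_const]
    refine Finset.sum_congr rfl fun ξ _ => Finset.sum_congr rfl fun η _ => Finset.sum_congr rfl fun q _ => Finset.sum_congr rfl fun r _ => ?_
    ring
  have e2 : (∑ p : Pd (n + k), ∑ q' : Pd (n + k), ind A p * ind B q' * ind C q' * (if TotDist p q' = true then (1:ℤ) else 0)) =
      ∑ ξ : Pd n, ∑ η : Pd n, ∑ q : Pd k, ∑ r : Pd k, (if TotDist ξ η = true then (1:ℤ) else 0) * (if TotDist q r = true then (1:ℤ) else 0) *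
        (ind A (glue ξ q) * ind B (glue η r) * ind C (glue η r)) := by
    rw [pairSum_glue (fun p q' => ind A p * ind B q' * ind C q')]
  have e3 : (∑ p : Pd (n + k), ∑ q' : Pd (n + k), ind B p * ind A q' * ind C q' * (if TotDist p q' = true then (1:ℤ) else 0)) =
      ∑ ξ : Pd n, ∑ η : Pd n, ∑ q : Pd k, ∑ r : Pd k, (if TotDist ξ η = true then (1:ℤ) else 0) * (if TotDist q r = true then (1:ℤ) else 0) *
        (ind B (glue ξ q) * ind A (glue η r) * ind C (glue η r)) := by
    rw [pairSum_glue (fun p q' => ind B p * ind A q' * ind C q')]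
  have e4 : (∑ p : Pd (n + k), ∑ q' : Pd (n + k), ind C p * ind A q' * ind B q' * (if TotDist p q' = true then (1:ℤ) else 0)) =
      ∑ ξ : Pd n, ∑ η : Pd n, ∑ q : Pd k, ∑ r : Pd k, (if TotDist ξ η = true then (1:ℤ) else 0) * (if TotDist q r = true then (1:ℤ) else 0) *
        (ind C (glue ξ q) * ind A (glue η r) * ind B (glue η r)) := by
    rw [pairSum_glue (fun p q' => ind C p * ind A q' * ind B q')]
  have e5 : (∑ q' : Pd (n + k), ∑ r' : Pd (n + k), ind B q' * ind C r' * ind A (thirdPt q' r') * (if TotDist q' r' = true then (1:ℤ) else 0)) =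
      ∑ ξ : Pd n, ∑ η : Pd n, ∑ q : Pd k, ∑ r : Pd k, (if TotDist ξ η = true then (1:ℤ) else 0) * (if TotDist q r = true then (1:ℤ) else 0) *
        (ind B (glue ξ q) * ind C (glue η r) * ind A (glue (thirdPt ξ η) (thirdPt q r))) := by
    rw [pairSum_glue (fun q' r' => ind B q' * ind C r' * ind A (thirdPt q' r'))]
    refine Finset.sum_congr rfl fun ξ _ => Finset.sum_congr rfl fun η _ => Finset.sum_congr rfl fun q _ => Finset.sum_congr rfl fun r _ => ?_
    rw [thirdPt_glue]
  rw [e1, e2, e3, e4, e5]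
  simp only [← Finset.sum_sub_distrib, ← Finset.sum_add_distrib]
  refine Finset.sum_congr rfl fun ξ _ => Finset.sum_congr rfl fun η _ => Finset.sum_congr rfl fun q _ => Finset.sum_congr rfl fun r _ => ?_
  ring

/-- **One literal axis explicit, any first slot**: for `A, B, C ⊆ [3]^{1+k}`, `sStarD A B C` is the pair sum over totally distinct `(q, r)` of
`[3]^k` of the three-copy kernel read at the six orderings `(i, j, l)` of the literal axis (sections `S_i = sect S i`). [this work] -/
private theorem sStarD_eq_pd1_sections' (A B C : Finset (Pd (1 + k))) :
    sStarD A B C = ∑ q : Pd k, ∑ r : Pd k, (if TotDist q r = true then (1:ℤ) else 0) *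
      ( (2 * ind A (glue (fun _ => 0) q) * ind B (glue (fun _ => 0) q) * ind C (glue (fun _ => 0) q) - ind A (glue (fun _ => 0) q) * ind B (glue (fun _ => 1) r) * ind C (glue (fun _ => 1) r) - ind B (glue (fun _ => 0) q) * ind A (glue (fun _ => 1) r) * ind C (glue (fun _ => 1) r) - ind C (glue (fun _ => 0) q) * ind A (glue (fun _ => 1) r) * ind B (glue (fun _ => 1) r) + ind B (glue (fun _ => 0) q) * ind C (glue (fun _ => 1) r) * ind A (glue (fun _ => 2) (thirdPt q r)))
        + (2 * ind A (glue (fun _ => 0) q) * ind B (glue (fun _ => 0) q) * ind C (glue (fun _ => 0) q) - ind A (glue (fun _ => 0) q) * ind B (glue (fun _ => 2) r) * ind C (glue (fun _ => 2) r) - ind B (glue (fun _ => 0) q) * ind A (glue (fun _ => 2) r) * ind C (glue (fun _ => 2) r) - ind C (glue (fun _ => 0) q) * ind A (glue (fun _ => 2) r) * ind B (glue (fun _ => 2) r) + ind B (glue (fun _ => 0) q) * ind C (glue (fun _ => 2) r) * ind A (glue (fun _ => 1) (thirdPt q r)))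
        + (2 * ind A (glue (fun _ => 1) q) * ind B (glue (fun _ => 1) q) * ind C (glue (fun _ => 1) q) - ind A (glue (fun _ => 1) q) * ind B (glue (fun _ => 0) r) * ind C (glue (fun _ => 0) r) - ind B (glue (fun _ => 1) q) * ind A (glue (fun _ => 0) r) * ind C (glue (fun _ => 0) r) - ind C (glue (fun _ => 1) q) * ind A (glue (fun _ => 0) r) * ind B (glue (fun _ => 0) r) + ind B (glue (fun _ => 1) q) * ind C (glue (fun _ => 0) r) * ind A (glue (fun _ => 2) (thirdPt q r)))
        + (2 * ind A (glue (fun _ => 1) q) * ind B (glue (fun _ => 1) q) * ind C (glue (fun _ => 1) q) - ind A (glue (fun _ => 1) q) * ind B (glue (fun _ => 2) r) * ind C (glue (fun _ => 2) r) - ind B (glue (fun _ => 1) q) * ind A (glue (fun _ => 2) r) * ind C (glue (fun _ => 2) r) - ind C (glue (fun _ => 1) q) * ind A (glue (fun _ => 2) r) * ind B (glue (fun _ => 2) r) + ind B (glue (fun _ => 1) q) * ind C (glue (fun _ => 2) r) * ind A (glue (fun _ => 0) (thirdPt q r)))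
        + (2 * ind A (glue (fun _ => 2) q) * ind B (glue (fun _ => 2) q) * ind C (glue (fun _ => 2) q) - ind A (glue (fun _ => 2) q) * ind B (glue (fun _ => 0) r) * ind C (glue (fun _ => 0) r) - ind B (glue (fun _ => 2) q) * ind A (glue (fun _ => 0) r) * ind C (glue (fun _ => 0) r) - ind C (glue (fun _ => 2) q) * ind A (glue (fun _ => 0) r) * ind B (glue (fun _ => 0) r) + ind B (glue (fun _ => 2) q) * ind C (glue (fun _ => 0) r) * ind A (glue (fun _ => 1) (thirdPt q r)))
        + (2 * ind A (glue (fun _ => 2) q) * ind B (glue (fun _ => 2) q) * ind C (glue (fun _ => 2) q) - ind A (glue (fun _ => 2) q) * ind B (glue (fun _ => 1) r) * ind C (glue (fun _ => 1) r) - ind B (glue (fun _ => 2) q) * ind A (glue (fun _ => 1) r) * ind C (glue (fun _ => 1) r) - ind C (glue (fun _ => 2) q) * ind A (glue (fun _ => 1) r) * ind B (glue (fun _ => 1) r) + ind B (glue (fun _ => 2) q) * ind C (glue (fun _ => 1) r) * ind A (glue (fun _ => 0) (thirdPt q r))) ) := by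
  obtain ⟨-, -, -, -, -, -, -, -, -, t01, t02, t10, t12, t20, t21⟩ := pd1_facts
  rw [sStarD_eq_glue_pairSum']
  rw [pairSum3_pd1_explicit (m := k) (fun (ξ η : Pd 1) (q r : Pd k) =>
        ( 2 * ind A (glue ξ q) * ind B (glue ξ q) * ind C (glue ξ q)
          - ind A (glue ξ q) * ind B (glue η r) * ind C (glue η r)
          - ind B (glue ξ q) * ind A (glue η r) * ind C (glue η r)
          - ind C (glue ξ q) * ind A (glue η r) * ind B (glue η r)
          + ind B (glue ξ q) * ind C (glue η r) * ind A (glue (thirdPt ξ η) (thirdPt q r)) ))]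
  simp only [t01, t02, t10, t12, t20, t21]



/-- Weighted fibre Kleitman: for up-sets `P, Q` and a pointwise-nonnegative weight `ω`,
`0 ≤ Σ_{z,z'}[z δ̸ z']·ω(z)·1_P(z')·(1_Q(z') − 1_Q(z̄z'))`. [this work] -/
theorem pairKernel_kleitman_nonneg_weight (ω : Pd d → ℤ) (hω : ∀ z, 0 ≤ ω z) (P Q : Finset (Pd d))
    (hP : IsUpperSet (P : Set (Pd d))) (hQ : IsUpperSet (Q : Set (Pd d))) :
    0 ≤ ∑ z : Pd d, ∑ z' : Pd d, (if TotDist z z' = true then (1:ℤ) else 0) * (ω z * ind P z' * (ind Q z' - ind Q (thirdPt z z'))) := by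
  refine Finset.sum_nonneg fun z _ => ?_
  have h := sum_fibre_third_le hP hQ z
  have e : (∑ z' : Pd d, (if TotDist z z' = true then (1:ℤ) else 0) * (ω z * ind P z' * (ind Q z' - ind Q (thirdPt z z'))))
      = ω z * ((∑ q, (if TotDist q z = true then (1 : ℤ) else 0) * (ind P q * ind Q q))
          - ∑ q, (if TotDist q z = true then (1 : ℤ) else 0) * (ind P q * ind Q (thirdPt q z))) := by
    rw [← Finset.sum_sub_distrib, Finset.mul_sum]
    refine Finset.sum_congr rfl fun q _ => ?_
    rw [totDist_symm z q, thirdPt_comm z q]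
    ring
  rw [e]
  exact mul_nonneg (hω z) (by linarith)

set_option maxHeartbeats 8000000 in
/-- **A LITERAL (threshold 2) AND A GOOD SET**: for every up-set `U' ⊆ [3]^k`, `A` with sections `(∅,∅,U')` and all
up-sets `B, C ⊆ [3]^{1+k}`: the stated combination of pattern functionals of `U'` is `≤ sStarD A B C`. [this work] -/
theorem sStarD_literalTwo_inter_ge {U' : Finset (Pd k)} (hU' : IsUpperSet (U' : Set (Pd k))) {A : Finset (Pd (1 + k))}
    (hA0 : ∀ z, ind A (glue (fun _ => 0) z) = 0) (hA1 : ∀ z, ind A (glue (fun _ => 1) z) = 0)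
    (hA2 : ∀ z, ind A (glue (fun _ => 2) z) = ind U' z)
    (B C : Finset (Pd (1 + k))) (hB : IsUpperSet (B : Set (Pd (1 + k)))) (hC : IsUpperSet (C : Set (Pd (1 + k)))) :
    2 * sStarD U' (sect B (fun _ => 2)) (sect C (fun _ => 2)) ≤ sStarD A B C := by
  have eA := sStarD_eq_pd1_sections' A B C
  simp only [hA0, hA1, hA2] at eA
  have eO0 := sStarD_eq_pairSum_kernel' U' (sect B (fun _ => 2)) (sect C (fun _ => 2))
  simp only [ind_sect] at eO0

  rw [eA, eO0]
  have dB : ∀ (s : Pd k) (i j : Fin 3), i ≤ j → 0 ≤ ind B (glue (fun _ => j) s) - ind B (glue (fun _ => i) s) := by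
    intro s i j hij
    have hle : glue (fun _ => i : Pd 1) s ≤ glue (fun _ => j) s := glue_le_glue_iff.2 ⟨fun _ => hij, le_rfl⟩
    linarith [ind_le_ind_of_imp (S := B) (T := B) (fun h => hB hle h)]
  have dC : ∀ (s : Pd k) (i j : Fin 3), i ≤ j → 0 ≤ ind C (glue (fun _ => j) s) - ind C (glue (fun _ => i) s) := by
    intro s i j hij
    have hle : glue (fun _ => i : Pd 1) s ≤ glue (fun _ => j) s := glue_le_glue_iff.2 ⟨fun _ => hij, le_rfl⟩
    linarith [ind_le_ind_of_imp (S := C) (T := C) (fun h => hC hle h)]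
  have hsB : ∀ ξ : Pd 1, IsUpperSet ((sect B ξ : Finset (Pd k)) : Set (Pd k)) := fun ξ => isUpperSet_sect hB ξ
  have hsC : ∀ ξ : Pd 1, IsUpperSet ((sect C ξ : Finset (Pd k)) : Set (Pd k)) := fun ξ => isUpperSet_sect hC ξ
  have hu0 : ∀ z : Pd k, 0 ≤ ind U' z := fun z => ind_nonneg' U' z
  have hu1 : ∀ z : Pd k, 0 ≤ 1 - ind U' z := fun z => by linarith [ind_le_one' U' z]
  have hu1' : ∀ z : Pd k, 0 ≤ 1 - ind U' z := hu1
  have ha0 : ∀ z : Pd k, 0 ≤ ind B (glue (fun _ => 0) z) := fun z => ind_nonneg' B _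
  have ha1 : ∀ z : Pd k, 0 ≤ ind B (glue (fun _ => 1) z) - ind B (glue (fun _ => 0) z) := fun z => dB z 0 1 (by decide)
  have ha2 : ∀ z : Pd k, 0 ≤ ind B (glue (fun _ => 2) z) - ind B (glue (fun _ => 1) z) := fun z => dB z 1 2 (by decide)
  have ha3 : ∀ z : Pd k, 0 ≤ 1 - ind B (glue (fun _ => 2) z) := fun z => by linarith [ind_le_one' B (glue (fun _ => 2) z)]
  have hb0 : ∀ z : Pd k, 0 ≤ ind C (glue (fun _ => 0) z) := fun z => ind_nonneg' C _
  have hb1 : ∀ z : Pd k, 0 ≤ ind C (glue (fun _ => 1) z) - ind C (glue (fun _ => 0) z) := fun z => dC z 0 1 (by decide)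
  have hb2 : ∀ z : Pd k, 0 ≤ ind C (glue (fun _ => 2) z) - ind C (glue (fun _ => 1) z) := fun z => dC z 1 2 (by decide)
  have hb3 : ∀ z : Pd k, 0 ≤ 1 - ind C (glue (fun _ => 2) z) := fun z => by linarith [ind_le_one' C (glue (fun _ => 2) z)]
  have G1 : 0 ≤ ∑ z : Pd k, ∑ z' : Pd k, (if TotDist z z' = true then (1:ℤ) else 0) * ((1 * 1 * ((ind C (glue (fun _ => 1) z) - ind C (glue (fun _ => 0) z)) + (ind C (glue (fun _ => 2) z) - ind C (glue (fun _ => 1) z)))) * (ind U' z') * ((ind B (glue (fun _ => 1) z')) - (ind B (glue (fun _ => 1) (thirdPt z z'))))) := by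
    have h := pairKernel_kleitman_nonneg_weight (fun z => 1 * 1 * ((ind C (glue (fun _ => 1) z) - ind C (glue (fun _ => 0) z)) + (ind C (glue (fun _ => 2) z) - ind C (glue (fun _ => 1) z)))) (fun z => mul_nonneg (mul_nonneg zero_le_one zero_le_one) (add_nonneg (hb1 z) (hb2 z))) U' (sect B (fun _ => 1)) hU' (hsB _)
    simp only [ind_sect] at h
    refine le_of_le_of_eq h ?_
    exact Finset.sum_congr rfl fun z _ => Finset.sum_congr rfl fun z' _ => by ring
  have G2 : 0 ≤ ∑ z : Pd k, ∑ z' : Pd k, (if TotDist z z' = true then (1:ℤ) else 0) * ((1 * 1 * (ind C (glue (fun _ => 2) z) - ind C (glue (fun _ => 1) z))) * (ind U' z') * ((ind B (glue (fun _ => 2) z')) - (ind B (glue (fun _ => 2) (thirdPt z z'))))) := by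
    have h := pairKernel_kleitman_nonneg_weight (fun z => 1 * 1 * (ind C (glue (fun _ => 2) z) - ind C (glue (fun _ => 1) z))) (fun z => mul_nonneg (mul_nonneg zero_le_one zero_le_one) (hb2 z)) U' (sect B (fun _ => 2)) hU' (hsB _)
    simp only [ind_sect] at h
    refine le_of_le_of_eq h ?_
    exact Finset.sum_congr rfl fun z _ => Finset.sum_congr rfl fun z' _ => by ring
  have G3 : 0 ≤ ∑ z : Pd k, ∑ z' : Pd k, (if TotDist z z' = true then (1:ℤ) else 0) * ((1 * (ind B (glue (fun _ => 1) z) - ind B (glue (fun _ => 0) z)) * 1) * (ind U' z') * ((ind C (glue (fun _ => 2) z')) - (ind C (glue (fun _ => 2) (thirdPt z z'))))) := by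
    have h := pairKernel_kleitman_nonneg_weight (fun z => 1 * (ind B (glue (fun _ => 1) z) - ind B (glue (fun _ => 0) z)) * 1) (fun z => mul_nonneg (mul_nonneg zero_le_one (ha1 z)) zero_le_one) U' (sect C (fun _ => 2)) hU' (hsC _)
    simp only [ind_sect] at h
    refine le_of_le_of_eq h ?_
    exact Finset.sum_congr rfl fun z _ => Finset.sum_congr rfl fun z' _ => by ring
  have G4 : 0 ≤ ∑ z : Pd k, ∑ z' : Pd k, (if TotDist z z' = true then (1:ℤ) else 0) * ((1 * (ind B (glue (fun _ => 2) z) - ind B (glue (fun _ => 1) z)) * 1) * (ind U' z') * ((ind C (glue (fun _ => 2) z')) - (ind C (glue (fun _ => 2) (thirdPt z z'))))) := by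
    have h := pairKernel_kleitman_nonneg_weight (fun z => 1 * (ind B (glue (fun _ => 2) z) - ind B (glue (fun _ => 1) z)) * 1) (fun z => mul_nonneg (mul_nonneg zero_le_one (ha2 z)) zero_le_one) U' (sect C (fun _ => 2)) hU' (hsC _)
    simp only [ind_sect] at h
    refine le_of_le_of_eq h ?_
    exact Finset.sum_congr rfl fun z _ => Finset.sum_congr rfl fun z' _ => by ring
  have PW : 0 ≤ ∑ z : Pd k, ∑ z' : Pd k, (if TotDist z z' = true then (1:ℤ) else 0) * ((ind U' z * ind B (glue (fun _ => 2) z') * (ind C (glue (fun _ => 2) z') - ind C (glue (fun _ => 1) z'))) + (ind U' z * ind B (glue (fun _ => 2) z') * (ind C (glue (fun _ => 2) z') - ind C (glue (fun _ => 0) z'))) + (ind U' z * (ind B (glue (fun _ => 2) z) - ind B (glue (fun _ => 1) z)) * (ind C (glue (fun _ => 2) z') - ind C (glue (fun _ => 0) z'))) + (ind U' z * (ind B (glue (fun _ => 2) z') - ind B (glue (fun _ => 1) z')) * ind C (glue (fun _ => 1) z')) + (ind U' z * (ind B (glue (fun _ => 2) z') - ind B (glue (fun _ => 0) z')) * ind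 C (glue (fun _ => 0) z')) + (ind U' z * (ind B (glue (fun _ => 2) z') - ind B (glue (fun _ => 0) z')) * (ind C (glue (fun _ => 2) (thirdPt z z')) - ind C (glue (fun _ => 1) (thirdPt z z'))))) := by
    refine Finset.sum_nonneg fun z _ => Finset.sum_nonneg fun z' _ => mul_nonneg (by split_ifs <;> norm_num) ?_
    linarith [mul_nonneg (mul_nonneg (ind_nonneg' U' z) (ind_nonneg' B (glue (fun _ => 2) z'))) (dC z' 1 2 (by decide)), mul_nonneg (mul_nonneg (ind_nonneg' U' z) (ind_nonneg' B (glue (fun _ => 2) z'))) (dC z' 0 2 (by decide)), mul_nonneg (mul_nonneg (ind_nonneg' U' z) (dB z 1 2 (by decide))) (dC z' 0 2 (by decide)), mul_nonneg (mul_nonneg (ind_nonneg' U' z) (dB z' 1 2 (by decide))) (ind_nonneg' C (glue (fun _ => 1) z')), mul_nonneg (mul_nonneg (ind_nonneg' U' z) (dB z' 0 2 (by decide))) (ind_nonneg' C (glue (fun _ => 0) z')), mul_nonneg (mul_nonneg (ind_nonneg' U' z) (dB z' 0 2 (by decide))) (dC (thirdPt z z') 1 2 (by decide))]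
  set pL : Pd k → Pd k → Pd k → ℤ := fun z z' z'' =>
      ((2 * 0 * ind B (glue (fun _ => 0) z) * ind C (glue (fun _ => 0) z) - 0 * ind B (glue (fun _ => 1) z') * ind C (glue (fun _ => 1) z') - ind B (glue (fun _ => 0) z) * 0 * ind C (glue (fun _ => 1) z') - ind C (glue (fun _ => 0) z) * 0 * ind B (glue (fun _ => 1) z') + ind B (glue (fun _ => 0) z) * ind C (glue (fun _ => 1) z') * ind U' z'')
        + (2 * 0 * ind B (glue (fun _ => 0) z) * ind C (glue (fun _ => 0) z) - 0 * ind B (glue (fun _ => 2) z') * ind C (glue (fun _ => 2) z') - ind B (glue (fun _ => 0) z) * ind U' z' * ind C (glue (fun _ => 2) z') - ind C (glue (fun _ => 0) z) * ind U' z' * ind B (glue (fun _ => 2) z') + ind B (glue (fun _ => 0) z) * ind C (glue (fun _ => 2) z') * 0)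
        + (2 * 0 * ind B (glue (fun _ => 1) z) * ind C (glue (fun _ => 1) z) - 0 * ind B (glue (fun _ => 0) z') * ind C (glue (fun _ => 0) z') - ind B (glue (fun _ => 1) z) * 0 * ind C (glue (fun _ => 0) z') - ind C (glue (fun _ => 1) z) * 0 * ind B (glue (fun _ => 0) z') + ind B (glue (fun _ => 1) z) * ind C (glue (fun _ => 0) z') * ind U' z'')
        + (2 * 0 * ind B (glue (fun _ => 1) z) * ind C (glue (fun _ => 1) z) - 0 * ind B (glue (fun _ => 2) z') * ind C (glue (fun _ => 2) z') - ind B (glue (fun _ => 1) z) * ind U' z' * ind C (glue (fun _ => 2) z') - ind C (glue (fun _ => 1) z) * ind U' z' * ind B (glue (fun _ => 2) z') + ind B (glue (fun _ => 1) z) * ind C (glue (fun _ => 2) z') * 0)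
        + (2 * ind U' z * ind B (glue (fun _ => 2) z) * ind C (glue (fun _ => 2) z) - ind U' z * ind B (glue (fun _ => 0) z') * ind C (glue (fun _ => 0) z') - ind B (glue (fun _ => 2) z) * 0 * ind C (glue (fun _ => 0) z') - ind C (glue (fun _ => 2) z) * 0 * ind B (glue (fun _ => 0) z') + ind B (glue (fun _ => 2) z) * ind C (glue (fun _ => 0) z') * 0)
        + (2 * ind U' z * ind B (glue (fun _ => 2) z) * ind C (glue (fun _ => 2) z) - ind U' z * ind B (glue (fun _ => 1) z') * ind C (glue (fun _ => 1) z') - ind B (glue (fun _ => 2) z) * 0 * ind C (glue (fun _ => 1) z') - ind C (glue (fun _ => 2) z) * 0 * ind B (glue (fun _ => 1) z') + ind B (glue (fun _ => 2) z) * ind C (glue (fun _ => 1) z') * 0))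
      - 2 * (ind B (glue (fun _ => 2) z) * ind C (glue (fun _ => 2) z) * (2 * ind U' z - ind U' z') - ind B (glue (fun _ => 2) z) * ind C (glue (fun _ => 2) z') * (ind U' z + ind U' z' - ind U' z'')) with hpL
  set pR : Pd k → Pd k → Pd k → ℤ := fun z z' z'' =>
      ((1 * 1 * ((ind C (glue (fun _ => 1) z) - ind C (glue (fun _ => 0) z)) + (ind C (glue (fun _ => 2) z) - ind C (glue (fun _ => 1) z)))) * (ind U' z') * ((ind B (glue (fun _ => 1) z')) - (ind B (glue (fun _ => 1) z''))))
      + ((1 * 1 * (ind C (glue (fun _ => 2) z) - ind C (glue (fun _ => 1) z))) * (ind U' z') * ((ind B (glue (fun _ => 2) z')) - (ind B (glue (fun _ => 2) z''))))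
      + ((1 * (ind B (glue (fun _ => 1) z) - ind B (glue (fun _ => 0) z)) * 1) * (ind U' z') * ((ind C (glue (fun _ => 2) z')) - (ind C (glue (fun _ => 2) z''))))
      + 2 * ((1 * (ind B (glue (fun _ => 2) z) - ind B (glue (fun _ => 1) z)) * 1) * (ind U' z') * ((ind C (glue (fun _ => 2) z')) - (ind C (glue (fun _ => 2) z''))))
      + ((ind U' z * ind B (glue (fun _ => 2) z') * (ind C (glue (fun _ => 2) z') - ind C (glue (fun _ => 1) z'))) + (ind U' z * ind B (glue (fun _ => 2) z') * (ind C (glue (fun _ => 2) z') - ind C (glue (fun _ => 0) z'))) + (ind U' z * (ind B (glue (fun _ => 2) z) - ind B (glue (fun _ => 1) z)) * (ind C (glue (fun _ => 2) z') - ind C (glue (fun _ => 0) z'))) + (ind U' z * (ind B (glue (fun _ => 2) z') - ind B (glue (fun _ => 1) z')) * ind C (glue (fun _ => 1) z')) + (ind U' z * (ind B (glue (fun _ => 2) z') - ind B (glue (fun _ => 0) z')) * ind C (glue (fun _ => 0) z')) + (ind U' z * (ind B (glue (fun _ => 2) z') - ind B (glue (fun _ => 0) z')) * (ind C (glue (fun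 _ => 2) z'') - ind C (glue (fun _ => 1) z'')))) with hpR
  have hsym : ∀ z z' z'' : Pd k, pL z z' z'' + pL z z'' z' + pL z' z z'' + pL z' z'' z + pL z'' z z' + pL z'' z' z
      = pR z z' z'' + pR z z'' z' + pR z' z z'' + pR z' z'' z + pR z'' z z' + pR z'' z' z := by
    intro z z' z''
    simp only [hpL, hpR]
    ring
  have k3 : (∑ z : Pd k, ∑ z' : Pd k, (if TotDist z z' = true then (1:ℤ) else 0) * pL z z' (thirdPt z z'))
      = ∑ z : Pd k, ∑ z' : Pd k, (if TotDist z z' = true then (1:ℤ) else 0) * pR z z' (thirdPt z z') := by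
    have h6 : 6 * (∑ z : Pd k, ∑ z' : Pd k, (if TotDist z z' = true then (1:ℤ) else 0) * pL z z' (thirdPt z z'))
        = 6 * (∑ z : Pd k, ∑ z' : Pd k, (if TotDist z z' = true then (1:ℤ) else 0) * pR z z' (thirdPt z z')) := by
      rw [pairSum_sym6 pL, pairSum_sym6 pR]
      exact Finset.sum_congr rfl fun z _ => Finset.sum_congr rfl fun z' _ => by rw [hsym]
    exact mul_left_cancel₀ (by norm_num : (6:ℤ) ≠ 0) h6
  have k2 : (∑ z : Pd k, ∑ z' : Pd k, (if TotDist z z' = true then (1:ℤ) else 0) * pR z z' (thirdPt z z'))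
      = (∑ z : Pd k, ∑ z' : Pd k, (if TotDist z z' = true then (1:ℤ) else 0) * ((1 * 1 * ((ind C (glue (fun _ => 1) z) - ind C (glue (fun _ => 0) z)) + (ind C (glue (fun _ => 2) z) - ind C (glue (fun _ => 1) z)))) * (ind U' z') * ((ind B (glue (fun _ => 1) z')) - (ind B (glue (fun _ => 1) (thirdPt z z')))))) + (∑ z : Pd k, ∑ z' : Pd k, (if TotDist z z' = true then (1:ℤ) else 0) * ((1 * 1 * (ind C (glue (fun _ => 2) z) - ind C (glue (fun _ => 1) z))) * (ind U' z') * ((ind B (glue (fun _ => 2) z')) - (ind B (glue (fun _ => 2) (thirdPt z z')))))) + (∑ z : Pd k, ∑ z' : Pd k, (if TotDist z z' = true then (1:ℤ) else 0) * ((1 * (ind B (glue (fun _ => 1) z) - ind B (glue (fun _ => 0) z)) * 1) * (ind U' z') * ((ind C (glue (fun _ => 2) z')) - (ind C (glue (fun _ => 2) (thirdPt z z')))))) + 2 * (∑ z : Pd k, ∑ z' : Pd k, (if TotDist z z' = true then (1:ℤ) else 0) * ((1 * (ind B (glue (fun _ => 2) z) - ind B (glue (fun _ => 1) z)) * 1)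 * (ind U' z') * ((ind C (glue (fun _ => 2) z')) - (ind C (glue (fun _ => 2) (thirdPt z z'))))))
        + (∑ z : Pd k, ∑ z' : Pd k, (if TotDist z z' = true then (1:ℤ) else 0) * ((ind U' z * ind B (glue (fun _ => 2) z') * (ind C (glue (fun _ => 2) z') - ind C (glue (fun _ => 1) z'))) + (ind U' z * ind B (glue (fun _ => 2) z') * (ind C (glue (fun _ => 2) z') - ind C (glue (fun _ => 0) z'))) + (ind U' z * (ind B (glue (fun _ => 2) z) - ind B (glue (fun _ => 1) z)) * (ind C (glue (fun _ => 2) z') - ind C (glue (fun _ => 0) z'))) + (ind U' z * (ind B (glue (fun _ => 2) z') - ind B (glue (fun _ => 1) z')) * ind C (glue (fun _ => 1) z')) + (ind U' z * (ind B (glue (fun _ => 2) z') - ind B (glue (fun _ => 0) z')) * ind C (glue (fun _ => 0) z')) + (ind U' z * (ind B (glue (fun _ => 2) z') - ind B (glue (fun _ => 0) z')) * (ind C (glue (fun _ => 2) (thirdPt z z')) - ind C (glue (fun _ => 1) (thirdPt z z')))))) := by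
    simp only [Finset.mul_sum, ← Finset.sum_add_distrib]
    refine Finset.sum_congr rfl fun z _ => Finset.sum_congr rfl fun z' _ => ?_
    simp only [hpR]
    ring
  have main : 0 ≤ ∑ z : Pd k, ∑ z' : Pd k, (if TotDist z z' = true then (1:ℤ) else 0) * pL z z' (thirdPt z z') := by
    rw [k3, k2]
    linarith [G1, G2, G3, G4, PW]
  rw [← sub_nonneg]
  refine le_of_le_of_eq main ?_
  simp only [Finset.mul_sum, ← Finset.sum_sub_distrib]
  refine Finset.sum_congr rfl fun z _ => Finset.sum_congr rfl fun z' _ => ?_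
  simp only [hpL]
  ring

set_option maxHeartbeats 8000000 in
/-- **A LITERAL (threshold 1) AND A GOOD SET**: for every up-set `U' ⊆ [3]^k`, `A` with sections `(∅,U',U')` and all
up-sets `B, C ⊆ [3]^{1+k}`: the stated combination of pattern functionals of `U'` is `≤ sStarD A B C`. [this work] -/
theorem sStarD_literalOne_inter_ge {U' : Finset (Pd k)} (hU' : IsUpperSet (U' : Set (Pd k))) {A : Finset (Pd (1 + k))}
    (hA0 : ∀ z, ind A (glue (fun _ => 0) z) = 0) (hA1 : ∀ z, ind A (glue (fun _ => 1) z) = ind U' z)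
    (hA2 : ∀ z, ind A (glue (fun _ => 2) z) = ind U' z)
    (B C : Finset (Pd (1 + k))) (hB : IsUpperSet (B : Set (Pd (1 + k)))) (hC : IsUpperSet (C : Set (Pd (1 + k)))) :
    2 * sStarD U' (sect B (fun _ => 1)) (sect C (fun _ => 1)) + 2 * sStarD U' (sect B (fun _ => 2)) (sect C (fun _ => 2)) ≤ sStarD A B C := by
  have eA := sStarD_eq_pd1_sections' A B C
  simp only [hA0, hA1, hA2] at eA
  have eO0 := sStarD_eq_pairSum_kernel' U' (sect B (fun _ => 1)) (sect C (fun _ => 1))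
  have eO1 := sStarD_eq_pairSum_kernel' U' (sect B (fun _ => 2)) (sect C (fun _ => 2))
  simp only [ind_sect] at eO0 eO1

  rw [eA, eO0, eO1]
  have dB : ∀ (s : Pd k) (i j : Fin 3), i ≤ j → 0 ≤ ind B (glue (fun _ => j) s) - ind B (glue (fun _ => i) s) := by
    intro s i j hij
    have hle : glue (fun _ => i : Pd 1) s ≤ glue (fun _ => j) s := glue_le_glue_iff.2 ⟨fun _ => hij, le_rfl⟩
    linarith [ind_le_ind_of_imp (S := B) (T := B) (fun h => hB hle h)]
  have dC : ∀ (s : Pd k) (i j : Fin 3), i ≤ j → 0 ≤ ind C (glue (fun _ => j) s) - ind C (glue (fun _ => i) s) := by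
    intro s i j hij
    have hle : glue (fun _ => i : Pd 1) s ≤ glue (fun _ => j) s := glue_le_glue_iff.2 ⟨fun _ => hij, le_rfl⟩
    linarith [ind_le_ind_of_imp (S := C) (T := C) (fun h => hC hle h)]
  have hsB : ∀ ξ : Pd 1, IsUpperSet ((sect B ξ : Finset (Pd k)) : Set (Pd k)) := fun ξ => isUpperSet_sect hB ξ
  have hsC : ∀ ξ : Pd 1, IsUpperSet ((sect C ξ : Finset (Pd k)) : Set (Pd k)) := fun ξ => isUpperSet_sect hC ξ
  have hu0 : ∀ z : Pd k, 0 ≤ ind U' z := fun z => ind_nonneg' U' z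
  have hu1 : ∀ z : Pd k, 0 ≤ 1 - ind U' z := fun z => by linarith [ind_le_one' U' z]
  have hu1' : ∀ z : Pd k, 0 ≤ 1 - ind U' z := hu1
  have ha0 : ∀ z : Pd k, 0 ≤ ind B (glue (fun _ => 0) z) := fun z => ind_nonneg' B _
  have ha1 : ∀ z : Pd k, 0 ≤ ind B (glue (fun _ => 1) z) - ind B (glue (fun _ => 0) z) := fun z => dB z 0 1 (by decide)
  have ha2 : ∀ z : Pd k, 0 ≤ ind B (glue (fun _ => 2) z) - ind B (glue (fun _ => 1) z) := fun z => dB z 1 2 (by decide)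
  have ha3 : ∀ z : Pd k, 0 ≤ 1 - ind B (glue (fun _ => 2) z) := fun z => by linarith [ind_le_one' B (glue (fun _ => 2) z)]
  have hb0 : ∀ z : Pd k, 0 ≤ ind C (glue (fun _ => 0) z) := fun z => ind_nonneg' C _
  have hb1 : ∀ z : Pd k, 0 ≤ ind C (glue (fun _ => 1) z) - ind C (glue (fun _ => 0) z) := fun z => dC z 0 1 (by decide)
  have hb2 : ∀ z : Pd k, 0 ≤ ind C (glue (fun _ => 2) z) - ind C (glue (fun _ => 1) z) := fun z => dC z 1 2 (by decide)
  have hb3 : ∀ z : Pd k, 0 ≤ 1 - ind C (glue (fun _ => 2) z) := fun z => by linarith [ind_le_one' C (glue (fun _ => 2) z)]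
  have G1 : 0 ≤ ∑ z : Pd k, ∑ z' : Pd k, (if TotDist z z' = true then (1:ℤ) else 0) * ((1 * 1 * (ind C (glue (fun _ => 1) z) - ind C (glue (fun _ => 0) z))) * (ind U' z') * ((ind B (glue (fun _ => 1) z')) - (ind B (glue (fun _ => 1) (thirdPt z z'))))) := by
    have h := pairKernel_kleitman_nonneg_weight (fun z => 1 * 1 * (ind C (glue (fun _ => 1) z) - ind C (glue (fun _ => 0) z))) (fun z => mul_nonneg (mul_nonneg zero_le_one zero_le_one) (hb1 z)) U' (sect B (fun _ => 1)) hU' (hsB _)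
    simp only [ind_sect] at h
    refine le_of_le_of_eq h ?_
    exact Finset.sum_congr rfl fun z _ => Finset.sum_congr rfl fun z' _ => by ring
  have G2 : 0 ≤ ∑ z : Pd k, ∑ z' : Pd k, (if TotDist z z' = true then (1:ℤ) else 0) * ((1 * 1 * ((ind C (glue (fun _ => 1) z) - ind C (glue (fun _ => 0) z)) + (ind C (glue (fun _ => 2) z) - ind C (glue (fun _ => 1) z)))) * (ind U' z') * ((ind B (glue (fun _ => 2) z')) - (ind B (glue (fun _ => 2) (thirdPt z z'))))) := by
    have h := pairKernel_kleitman_nonneg_weight (fun z => 1 * 1 * ((ind C (glue (fun _ => 1) z) - ind C (glue (fun _ => 0) z)) + (ind C (glue (fun _ => 2) z) - ind C (glue (fun _ => 1) z)))) (fun z => mul_nonneg (mul_nonneg zero_le_one zero_le_one) (add_nonneg (hb1 z) (hb2 z))) U' (sect B (fun _ => 2)) hU' (hsB _)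
    simp only [ind_sect] at h
    refine le_of_le_of_eq h ?_
    exact Finset.sum_congr rfl fun z _ => Finset.sum_congr rfl fun z' _ => by ring
  have G3 : 0 ≤ ∑ z : Pd k, ∑ z' : Pd k, (if TotDist z z' = true then (1:ℤ) else 0) * ((1 * (ind B (glue (fun _ => 1) z) - ind B (glue (fun _ => 0) z)) * 1) * (ind U' z') * ((ind C (glue (fun _ => 1) z')) - (ind C (glue (fun _ => 1) (thirdPt z z'))))) := by
    have h := pairKernel_kleitman_nonneg_weight (fun z => 1 * (ind B (glue (fun _ => 1) z) - ind B (glue (fun _ => 0) z)) * 1) (fun z => mul_nonneg (mul_nonneg zero_le_one (ha1 z)) zero_le_one) U' (sect C (fun _ => 1)) hU' (hsC _)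
    simp only [ind_sect] at h
    refine le_of_le_of_eq h ?_
    exact Finset.sum_congr rfl fun z _ => Finset.sum_congr rfl fun z' _ => by ring
  have G4 : 0 ≤ ∑ z : Pd k, ∑ z' : Pd k, (if TotDist z z' = true then (1:ℤ) else 0) * ((1 * ((ind B (glue (fun _ => 1) z) - ind B (glue (fun _ => 0) z)) + (ind B (glue (fun _ => 2) z) - ind B (glue (fun _ => 1) z))) * 1) * (ind U' z') * ((ind C (glue (fun _ => 2) z')) - (ind C (glue (fun _ => 2) (thirdPt z z'))))) := by
    have h := pairKernel_kleitman_nonneg_weight (fun z => 1 * ((ind B (glue (fun _ => 1) z) - ind B (glue (fun _ => 0) z)) + (ind B (glue (fun _ => 2) z) - ind B (glue (fun _ => 1) z))) * 1) (fun z => mul_nonneg (mul_nonneg zero_le_one (add_nonneg (ha1 z) (ha2 z))) zero_le_one) U' (sect C (fun _ => 2)) hU' (hsC _)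
    simp only [ind_sect] at h
    refine le_of_le_of_eq h ?_
    exact Finset.sum_congr rfl fun z _ => Finset.sum_congr rfl fun z' _ => by ring
  have PW : 0 ≤ ∑ z : Pd k, ∑ z' : Pd k, (if TotDist z z' = true then (1:ℤ) else 0) * ((ind U' z * ind B (glue (fun _ => 0) z') * (ind C (glue (fun _ => 1) z') - ind C (glue (fun _ => 0) z'))) + (ind U' z * ind B (glue (fun _ => 0) z') * (ind C (glue (fun _ => 2) z') - ind C (glue (fun _ => 0) z'))) + (ind U' z * (ind B (glue (fun _ => 1) z') - ind B (glue (fun _ => 0) z')) * ind C (glue (fun _ => 1) z')) + (ind U' z * (ind B (glue (fun _ => 2) z) - ind B (glue (fun _ => 1) z)) * (ind C (glue (fun _ => 2) z') - ind C (glue (fun _ => 1) z'))) + (ind U' z * (ind B (glue (fun _ => 2) z') - ind B (glue (fun _ => 1) z')) * (ind C (glue (fun _ => 2) z) - ind C (glue (fun _ => 1) z))) + (ind U' z * (ind B (glue (fun _ => 2) z') - ind B (glue (fun _ => 0) z')) * ind C (glue (fun _ => 2) z'))) := by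
    refine Finset.sum_nonneg fun z _ => Finset.sum_nonneg fun z' _ => mul_nonneg (by split_ifs <;> norm_num) ?_
    linarith [mul_nonneg (mul_nonneg (ind_nonneg' U' z) (ind_nonneg' B (glue (fun _ => 0) z'))) (dC z' 0 1 (by decide)), mul_nonneg (mul_nonneg (ind_nonneg' U' z) (ind_nonneg' B (glue (fun _ => 0) z'))) (dC z' 0 2 (by decide)), mul_nonneg (mul_nonneg (ind_nonneg' U' z) (dB z' 0 1 (by decide))) (ind_nonneg' C (glue (fun _ => 1) z')), mul_nonneg (mul_nonneg (ind_nonneg' U' z) (dB z 1 2 (by decide))) (dC z' 1 2 (by decide)), mul_nonneg (mul_nonneg (ind_nonneg' U' z) (dB z' 1 2 (by decide))) (dC z 1 2 (by decide)), mul_nonneg (mul_nonneg (ind_nonneg' U' z) (dB z' 0 2 (by decide))) (ind_nonneg' C (glue (fun _ => 2) z'))]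
  set pL : Pd k → Pd k → Pd k → ℤ := fun z z' z'' =>
      ((2 * 0 * ind B (glue (fun _ => 0) z) * ind C (glue (fun _ => 0) z) - 0 * ind B (glue (fun _ => 1) z') * ind C (glue (fun _ => 1) z') - ind B (glue (fun _ => 0) z) * ind U' z' * ind C (glue (fun _ => 1) z') - ind C (glue (fun _ => 0) z) * ind U' z' * ind B (glue (fun _ => 1) z') + ind B (glue (fun _ => 0) z) * ind C (glue (fun _ => 1) z') * ind U' z'')
        + (2 * 0 * ind B (glue (fun _ => 0) z) * ind C (glue (fun _ => 0) z) - 0 * ind B (glue (fun _ => 2) z') * ind C (glue (fun _ => 2) z') - ind B (glue (fun _ => 0) z) * ind U' z' * ind C (glue (fun _ => 2) z') - ind C (glue (fun _ => 0) z) * ind U' z' * ind B (glue (fun _ => 2) z') + ind B (glue (fun _ => 0) z) * ind C (glue (fun _ => 2) z') * ind U' z'')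
        + (2 * ind U' z * ind B (glue (fun _ => 1) z) * ind C (glue (fun _ => 1) z) - ind U' z * ind B (glue (fun _ => 0) z') * ind C (glue (fun _ => 0) z') - ind B (glue (fun _ => 1) z) * 0 * ind C (glue (fun _ => 0) z') - ind C (glue (fun _ => 1) z) * 0 * ind B (glue (fun _ => 0) z') + ind B (glue (fun _ => 1) z) * ind C (glue (fun _ => 0) z') * ind U' z'')
        + (2 * ind U' z * ind B (glue (fun _ => 1) z) * ind C (glue (fun _ => 1) z) - ind U' z * ind B (glue (fun _ => 2) z') * ind C (glue (fun _ => 2) z') - ind B (glue (fun _ => 1) z) * ind U' z' * ind C (glue (fun _ => 2) z') - ind C (glue (fun _ => 1) z) * ind U' z' * ind B (glue (fun _ => 2) z') + ind B (glue (fun _ => 1) z) * ind C (glue (fun _ => 2) z') * 0)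
        + (2 * ind U' z * ind B (glue (fun _ => 2) z) * ind C (glue (fun _ => 2) z) - ind U' z * ind B (glue (fun _ => 0) z') * ind C (glue (fun _ => 0) z') - ind B (glue (fun _ => 2) z) * 0 * ind C (glue (fun _ => 0) z') - ind C (glue (fun _ => 2) z) * 0 * ind B (glue (fun _ => 0) z') + ind B (glue (fun _ => 2) z) * ind C (glue (fun _ => 0) z') * ind U' z'')
        + (2 * ind U' z * ind B (glue (fun _ => 2) z) * ind C (glue (fun _ => 2) z) - ind U' z * ind B (glue (fun _ => 1) z') * ind C (glue (fun _ => 1) z') - ind B (glue (fun _ => 2) z) * ind U' z' * ind C (glue (fun _ => 1) z') - ind C (glue (fun _ => 2) z) * ind U' z' * ind B (glue (fun _ => 1) z') + ind B (glue (fun _ => 2) z) * ind C (glue (fun _ => 1) z') * 0))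
      - 2 * (ind B (glue (fun _ => 1) z) * ind C (glue (fun _ => 1) z) * (2 * ind U' z - ind U' z') - ind B (glue (fun _ => 1) z) * ind C (glue (fun _ => 1) z') * (ind U' z + ind U' z' - ind U' z''))
      - 2 * (ind B (glue (fun _ => 2) z) * ind C (glue (fun _ => 2) z) * (2 * ind U' z - ind U' z') - ind B (glue (fun _ => 2) z) * ind C (glue (fun _ => 2) z') * (ind U' z + ind U' z' - ind U' z'')) with hpL
  set pR : Pd k → Pd k → Pd k → ℤ := fun z z' z'' =>
      ((1 * 1 * (ind C (glue (fun _ => 1) z) - ind C (glue (fun _ => 0) z))) * (ind U' z') * ((ind B (glue (fun _ => 1) z')) - (ind B (glue (fun _ => 1) z''))))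
      + ((1 * 1 * ((ind C (glue (fun _ => 1) z) - ind C (glue (fun _ => 0) z)) + (ind C (glue (fun _ => 2) z) - ind C (glue (fun _ => 1) z)))) * (ind U' z') * ((ind B (glue (fun _ => 2) z')) - (ind B (glue (fun _ => 2) z''))))
      + ((1 * (ind B (glue (fun _ => 1) z) - ind B (glue (fun _ => 0) z)) * 1) * (ind U' z') * ((ind C (glue (fun _ => 1) z')) - (ind C (glue (fun _ => 1) z''))))
      + ((1 * ((ind B (glue (fun _ => 1) z) - ind B (glue (fun _ => 0) z)) + (ind B (glue (fun _ => 2) z) - ind B (glue (fun _ => 1) z))) * 1) * (ind U' z') * ((ind C (glue (fun _ => 2) z')) - (ind C (glue (fun _ => 2) z''))))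
      + ((ind U' z * ind B (glue (fun _ => 0) z') * (ind C (glue (fun _ => 1) z') - ind C (glue (fun _ => 0) z'))) + (ind U' z * ind B (glue (fun _ => 0) z') * (ind C (glue (fun _ => 2) z') - ind C (glue (fun _ => 0) z'))) + (ind U' z * (ind B (glue (fun _ => 1) z') - ind B (glue (fun _ => 0) z')) * ind C (glue (fun _ => 1) z')) + (ind U' z * (ind B (glue (fun _ => 2) z) - ind B (glue (fun _ => 1) z)) * (ind C (glue (fun _ => 2) z') - ind C (glue (fun _ => 1) z'))) + (ind U' z * (ind B (glue (fun _ => 2) z') - ind B (glue (fun _ => 1) z')) * (ind C (glue (fun _ => 2) z) - ind C (glue (fun _ => 1) z))) + (ind U' z * (ind B (glue (fun _ => 2) z') - ind B (glue (fun _ => 0) z')) * ind C (glue (fun _ => 2) z'))) with hpR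
  have hsym : ∀ z z' z'' : Pd k, pL z z' z'' + pL z z'' z' + pL z' z z'' + pL z' z'' z + pL z'' z z' + pL z'' z' z
      = pR z z' z'' + pR z z'' z' + pR z' z z'' + pR z' z'' z + pR z'' z z' + pR z'' z' z := by
    intro z z' z''
    simp only [hpL, hpR]
    ring
  have k3 : (∑ z : Pd k, ∑ z' : Pd k, (if TotDist z z' = true then (1:ℤ) else 0) * pL z z' (thirdPt z z'))
      = ∑ z : Pd k, ∑ z' : Pd k, (if TotDist z z' = true then (1:ℤ) else 0) * pR z z' (thirdPt z z') := by
    have h6 : 6 * (∑ z : Pd k, ∑ z' : Pd k, (if TotDist z z' = true then (1:ℤ) else 0) * pL z z' (thirdPt z z'))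
        = 6 * (∑ z : Pd k, ∑ z' : Pd k, (if TotDist z z' = true then (1:ℤ) else 0) * pR z z' (thirdPt z z')) := by
      rw [pairSum_sym6 pL, pairSum_sym6 pR]
      exact Finset.sum_congr rfl fun z _ => Finset.sum_congr rfl fun z' _ => by rw [hsym]
    exact mul_left_cancel₀ (by norm_num : (6:ℤ) ≠ 0) h6
  have k2 : (∑ z : Pd k, ∑ z' : Pd k, (if TotDist z z' = true then (1:ℤ) else 0) * pR z z' (thirdPt z z'))
      = (∑ z : Pd k, ∑ z' : Pd k, (if TotDist z z' = true then (1:ℤ) else 0) * ((1 * 1 * (ind C (glue (fun _ => 1) z) - ind C (glue (fun _ => 0) z))) * (ind U' z') * ((ind B (glue (fun _ => 1) z')) - (ind B (glue (fun _ => 1) (thirdPt z z')))))) + (∑ z : Pd k, ∑ z' : Pd k, (if TotDist z z' = true then (1:ℤ) else 0) * ((1 * 1 * ((ind C (glue (fun _ => 1) z) - ind C (glue (fun _ => 0) z)) + (ind C (glue (fun _ => 2) z) - ind C (glue (fun _ => 1) z)))) * (ind U' z') * ((ind B (glue (fun _ => 2) z')) - (ind B (glue (fun _ => 2) (thirdPt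 z z')))))) + (∑ z : Pd k, ∑ z' : Pd k, (if TotDist z z' = true then (1:ℤ) else 0) * ((1 * (ind B (glue (fun _ => 1) z) - ind B (glue (fun _ => 0) z)) * 1) * (ind U' z') * ((ind C (glue (fun _ => 1) z')) - (ind C (glue (fun _ => 1) (thirdPt z z')))))) + (∑ z : Pd k, ∑ z' : Pd k, (if TotDist z z' = true then (1:ℤ) else 0) * ((1 * ((ind B (glue (fun _ => 1) z) - ind B (glue (fun _ => 0) z)) + (ind B (glue (fun _ => 2) z) - ind B (glue (fun _ => 1) z))) * 1) * (ind U' z') * ((ind C (glue (fun _ => 2) z')) - (ind C (glue (fun _ => 2) (thirdPt z z'))))))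
        + (∑ z : Pd k, ∑ z' : Pd k, (if TotDist z z' = true then (1:ℤ) else 0) * ((ind U' z * ind B (glue (fun _ => 0) z') * (ind C (glue (fun _ => 1) z') - ind C (glue (fun _ => 0) z'))) + (ind U' z * ind B (glue (fun _ => 0) z') * (ind C (glue (fun _ => 2) z') - ind C (glue (fun _ => 0) z'))) + (ind U' z * (ind B (glue (fun _ => 1) z') - ind B (glue (fun _ => 0) z')) * ind C (glue (fun _ => 1) z')) + (ind U' z * (ind B (glue (fun _ => 2) z) - ind B (glue (fun _ => 1) z)) * (ind C (glue (fun _ => 2) z') - ind C (glue (fun _ => 1) z'))) + (ind U' z * (ind B (glue (fun _ => 2) z') - ind B (glue (fun _ => 1) z')) * (ind C (glue (fun _ => 2) z) - ind C (glue (fun _ => 1) z))) + (ind U' z * (ind B (glue (fun _ => 2) z') - ind B (glue (fun _ => 0) z')) * ind C (glue (fun _ => 2) z')))) := by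
    simp only [← Finset.sum_add_distrib]
    refine Finset.sum_congr rfl fun z _ => Finset.sum_congr rfl fun z' _ => ?_
    simp only [hpR]
    ring
  have main : 0 ≤ ∑ z : Pd k, ∑ z' : Pd k, (if TotDist z z' = true then (1:ℤ) else 0) * pL z z' (thirdPt z z') := by
    rw [k3, k2]
    linarith [G1, G2, G3, G4, PW]
  rw [← sub_nonneg]
  refine le_of_le_of_eq main ?_
  simp only [Finset.mul_sum, ← Finset.sum_add_distrib, ← Finset.sum_sub_distrib]
  refine Finset.sum_congr rfl fun z _ => Finset.sum_congr rfl fun z' _ => ?_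
  simp only [hpL]
  ring


/-- **A good set intersected with a threshold-two literal is good**: `U'` good in dim `k` ⇒ `{ξ=2} × U'` good in dim `1+k`. [this work] -/
theorem sStarD_literalTwo_inter_nonneg_of_good {U' : Finset (Pd k)} (hU' : IsUpperSet (U' : Set (Pd k)))
    (hgood : ∀ P R : Finset (Pd k), IsUpperSet (P : Set (Pd k)) → IsUpperSet (R : Set (Pd k)) → 0 ≤ sStarD U' P R)
    {A : Finset (Pd (1 + k))} (hA0 : ∀ z, ind A (glue (fun _ => 0) z) = 0) (hA1 : ∀ z, ind A (glue (fun _ => 1) z) = 0)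
    (hA2 : ∀ z, ind A (glue (fun _ => 2) z) = ind U' z)
    (B C : Finset (Pd (1 + k))) (hB : IsUpperSet (B : Set (Pd (1 + k)))) (hC : IsUpperSet (C : Set (Pd (1 + k)))) :
    0 ≤ sStarD A B C := by
  have h := sStarD_literalTwo_inter_ge hU' hA0 hA1 hA2 B C hB hC
  have h1 := hgood (sect B (fun _ => 2)) (sect C (fun _ => 2)) (isUpperSet_sect hB _) (isUpperSet_sect hC _)
  linarith

/-- **A good set intersected with a threshold-one literal is good**: `U'` good in dim `k` ⇒ `{ξ≥1} × U'` good in dim `1+k`. [this work] -/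
theorem sStarD_literalOne_inter_nonneg_of_good {U' : Finset (Pd k)} (hU' : IsUpperSet (U' : Set (Pd k)))
    (hgood : ∀ P R : Finset (Pd k), IsUpperSet (P : Set (Pd k)) → IsUpperSet (R : Set (Pd k)) → 0 ≤ sStarD U' P R)
    {A : Finset (Pd (1 + k))} (hA0 : ∀ z, ind A (glue (fun _ => 0) z) = 0) (hA1 : ∀ z, ind A (glue (fun _ => 1) z) = ind U' z)
    (hA2 : ∀ z, ind A (glue (fun _ => 2) z) = ind U' z)
    (B C : Finset (Pd (1 + k))) (hB : IsUpperSet (B : Set (Pd (1 + k)))) (hC : IsUpperSet (C : Set (Pd (1 + k)))) :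
    0 ≤ sStarD A B C := by
  have h := sStarD_literalOne_inter_ge hU' hA0 hA1 hA2 B C hB hC
  have h1 := hgood (sect B (fun _ => 1)) (sect C (fun _ => 1)) (isUpperSet_sect hB _) (isUpperSet_sect hC _)
  have h2 := hgood (sect B (fun _ => 2)) (sect C (fun _ => 2)) (isUpperSet_sect hB _) (isUpperSet_sect hC _)
  linarith

end Summit.CriticalPhenomena.PercolationContinuityZ3.Theorems.SahiGridPattern
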